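import Literature.Computability.AlgebraicComplexity.Yab15BRankProofs
import Literature.Computability.AlgebraicComplexity.Yab15BRankProp52
import Literature.Computability.AlgebraicComplexity.Yab15BRankLowDegree
import HarnessLib

/-!
# Yabe 2015, Theorem 1.5 (main theorem) — PROVED

Topic `Literature/Computability/AlgebraicComplexity`; sibling proofs file of `Yab15BRank.lean`
(A. Yabe, *Bi-polynomial rank and determinantal complexity*, arXiv:1504.00151, typed by val-lit
t17). This file DISCHARGES the main theorem `yabe2015_thm_1_5` (p0003): for a field `K`,
`p ∈ K[x_1,…,x_D]`, `1 ≤ k ≤ D` and `x₀ ∈ Zeros(p)`,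

  `dc(p) ≥ 2^{-(2k-2)} · brank((p_{x₀})^{(2k)}) − 2(k−1)·D^{k−1}`

(typed with denominators cleared). It assembles the three proofs files:
`Yab15BRankProofs.lean` (Lemma 5.1, `yabe2015_lemma_5_1_holds`), `Yab15BRankProp52.lean`
(Prop. 5.2, `yabe2015_prop_5_2_holds`) and `Yab15BRankLowDegree.lean` (Lemma 5.3 (i), the
low-degree parts, the `r = n - 2k` bound and the reduction `Yabe.yabe2015_thm_1_5_of`).

Honest framing: a published lower-bound TEMPLATE is now kernel-checked; it yields a concrete bound
only together with a `brank` lower bound at some zero (Cor. 1.6 / Prop. 1.8), none of which is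
claimed here; nothing in this file bears on `VP ≠ VNP`.

## References

* [Yabe2015] A. Yabe, *Bi-polynomial rank and determinantal complexity*, arXiv:1504.00151 (2015),
  Theorem 1.5 (p. 3) and its proof (§5, pp. 11–15).
-/

namespace Literature.Computability.AlgebraicComplexity

/-- **Yabe 2015, Theorem 1.5 — PROVED**: `brank((p_{x₀})^{(2k)}) ≤ 2^{2k-2}·(dc(p) + 2(k-1)·D^{k-1})`
for `1 ≤ k ≤ D` and `x₀ ∈ Zeros(p)` (Lemma 5.1 + Prop. 5.2 + Lemma 5.3, as printed, with
Lemma 5.3 (ii) replaced by a first-column Laplace expansion). [cite: Yabe2015, Theorem 1.5] -/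
theorem yabe2015_thm_1_5_holds : yabe2015_thm_1_5 :=
  Yabe.yabe2015_thm_1_5_of yabe2015_prop_5_2_holds yabe2015_lemma_5_1_holds

end Literature.Computability.AlgebraicComplexity
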